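import Mathlib
import Literature.NumberTheory.LFunctions.Zhang2022.Section16Lemma162RTwo
import Literature.NumberTheory.LFunctions.Zhang2022.Section16Lemma162RAnalytic
import Literature.NumberTheory.LFunctions.Zhang2022.AppendixAPrimeProducts
import Literature.NumberTheory.LFunctions.MertensElementary
import HarnessLib

/-!
# Zhang (2022) §16 Lemma 16.2 at the repaired normaliser (GAP row G-d57-1), part 8: the main term
# `(6/π²)·φ(D)/(D𝔭)·∏_{q∣D} q/(q+1)` as the Euler product of the model factors

Topic `Literature/NumberTheory/LFunctions/Zhang2022` (Landau–Siegel audit tree; verdict-neutral).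
Y. Zhang, *Discrete mean estimates and the Landau–Siegel zero*, arXiv:2211.02515v1 (2022)
[Zhang2022LandauSiegel] — **an unrefereed manuscript under adjudication; nothing here asserts or denies
its Theorems 1–2.** ZHANG-L WP16 block D, sub-leaf `Typed.Section16B.Lemma162R`, clause (iv). Theorems only.

The model factors of parts 6–7 — `m_q = (1−q⁻¹)²` (`χ(q) = 0`), `3/8` (`q = 2`, `χ(2) = 1`),
`(1−q⁻²)/M_q` otherwise (`M_q = frakpFactor χ q`) — multiply to Lemma 16.2's main term:
`∏'_q m_q = frakU2Main χ = (6/π²)·φ(D)/(D·𝔭)·∏_{q∣D} q/(q+1)` (`hasProd_model`), using `∏_q(1−q⁻²) = ζ(2)⁻¹ = 6/π²`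
(Mathlib), `φ(D)/D = ∏_{q∣D}(1−q⁻¹)`, and `𝔭 = ∏_q M_q` resp. `2∏_{q>2} M_q` (Lemma 16.1, u028/u029).

## References

* Y. Zhang, arXiv:2211.02515v1 (2022), §16 Lemma 16.1 p. 92, Lemma 16.2 p. 94.
  [cite: Zhang2022LandauSiegel, §16 Lemma 16.2 p.94]
-/

noncomputable section

open Complex Real Finset Filter Topology

namespace Literature.NumberTheory.LFunctions.Zhang2022.Lemma162R

open Literature.NumberTheory.LFunctions.Zhang2022
open Literature.NumberTheory.LFunctions.Zhang2022.Skeleton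
open Literature.NumberTheory.LFunctions.Zhang2022.Typed.Section16A
open Literature.NumberTheory.LFunctions.Zhang2022.Typed.Section16B
open Literature.NumberTheory.LFunctions.Zhang2022.AppendixA

section ModelProduct

variable {D : ℕ} (χ : DirichletCharacter ℂ D)

/-- An Euler product with nonvanishing value may be inverted factorwise (in `ℂ`). [folklore] -/
private theorem hasProd_inv_of_ne_zero' {ι : Type*} {f : ι → ℂ} {a : ℂ} (hf : HasProd f a)
    (ha : a ≠ 0) : HasProd (fun i => (f i)⁻¹) a⁻¹ := by
  classical
  have hT : Tendsto (fun A : Finset ι => ∏ i ∈ A, f i) atTop (𝓝 a) := hf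
  have hT' := hT.inv₀ ha
  have hfun : (fun A : Finset ι => ∏ i ∈ A, (f i)⁻¹) = fun A => (∏ i ∈ A, f i)⁻¹ := by
    funext A; rw [Finset.prod_inv_distrib]
  show Tendsto (fun A : Finset ι => ∏ i ∈ A, (f i)⁻¹) atTop (𝓝 a⁻¹)
  rw [hfun]; exact hT'

/-- **`∏_q (1 − q⁻²) = 6/π²`** (`= ζ(2)⁻¹`, Euler). [cite: Zhang2022LandauSiegel, §16 Lemma 16.2 p.94] -/
theorem hasProd_one_sub_inv_sq :
    HasProd (fun q : Nat.Primes => 1 - (((q : ℕ) : ℂ) ^ (-(1 : ℂ))) ^ 2) (((6 / Real.pi ^ 2 : ℝ) : ℂ)) := by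
  have h2 : 1 < (2 : ℂ).re := by norm_num
  have hζ := riemannZeta_eulerProduct_hasProd h2
  have hne : riemannZeta 2 ≠ 0 := riemannZeta_ne_zero_of_one_lt_re h2
  have h := hasProd_inv_of_ne_zero' hζ hne
  simp only [inv_inv] at h
  have hval : (riemannZeta 2)⁻¹ = (((6 / Real.pi ^ 2 : ℝ) : ℂ)) := by
    rw [riemannZeta_two]; push_cast; rw [inv_div]
  rw [← hval]
  refine h.congr_fun fun q => ?_
  congr 1
  rw [← Complex.cpow_nat_mul]; norm_num

/-- `frakpFactor χ q = 1` at a prime with `χ(q) = 0`, and `‖frakpFactor χ q − 1‖ ≤ 4/q²` always.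
[cite: Zhang2022LandauSiegel, §16 Lemma 16.1 p.92] -/
theorem frakpFactor_facts {q : ℕ} (hq : q.Prime) :
    (χ (q : ZMod D) = 0 → frakpFactor χ q = 1) ∧ ‖frakpFactor χ q - 1‖ ≤ 4 / (q : ℝ) ^ 2 := by
  constructor
  · intro h; simp [frakpFactor, h]
  · rw [frakpFactor_eq_locMain]
    exact norm_locMain_sub_one_le (χ.norm_le_one _) hq.two_le

/-- The Euler products `∏_q frakpFactor χ q` and `∏_q (q = 2 ? 1 : frakpFactor χ q)` converge (factors
`1 + O(q⁻²)`), with values `frakpA χ` resp. `frakpB χ / 2`. [cite: Zhang2022LandauSiegel, §16 Lemma 16.1 p.92] -/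
theorem hasProd_frakpFactor :
    HasProd (fun q : Nat.Primes => frakpFactor χ q) (frakpA χ) ∧
      HasProd (fun q : Nat.Primes => if (q : ℕ) = 2 then (1 : ℂ) else frakpFactor χ q) (frakpB χ / 2) := by
  have hsum : Summable fun q : Nat.Primes => ‖frakpFactor χ (q : ℕ) - 1‖ := by
    have h4 : Summable fun q : Nat.Primes => 4 * ((q : ℕ) : ℝ) ^ (-(2 : ℝ)) :=
      (Nat.Primes.summable_rpow.mpr (by norm_num)).mul_left 4
    refine Summable.of_nonneg_of_le (fun _ => norm_nonneg _) (fun q => ?_) h4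
    have := (frakpFactor_facts χ q.prop).2
    rw [Real.rpow_neg (Nat.cast_nonneg _), Real.rpow_two, ← div_eq_mul_inv]
    exact this
  have hm1 : Multipliable fun q : Nat.Primes => frakpFactor χ q := by
    have h := multipliable_one_add_of_summable hsum
    simpa only [add_sub_cancel] using h
  have hsum2 : Summable fun q : Nat.Primes => ‖(if (q : ℕ) = 2 then (1 : ℂ) else frakpFactor χ q) - 1‖ := by
    refine Summable.of_nonneg_of_le (fun _ => norm_nonneg _) (fun q => ?_) hsum
    split_ifs
    · simp
    · exact le_rfl
  have hm2 : Multipliable fun q : Nat.Primes => if (q : ℕ) = 2 then (1 : ℂ) else frakpFactor χ q := by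
    have h := multipliable_one_add_of_summable hsum2
    simpa only [add_sub_cancel] using h
  refine ⟨?_, ?_⟩
  · exact hm1.hasProd
  · have : frakpB χ / 2 = ∏' q : Nat.Primes, (if (q : ℕ) = 2 then (1 : ℂ) else frakpFactor χ q) := by
      unfold frakpB; ring
    rw [this]; exact hm2.hasProd

/-- **`φ(D)/D · ∏_{q∣D} q/(q+1) = ∏_{q∣D} (1 − q⁻¹)²/(1 − q⁻²)`** (`D ≥ 1`): `φ(D)/D = ∏_{q∣D}(1 − q⁻¹)` and
`(1−q⁻¹)²/(1−q⁻²) = (1−q⁻¹)·q/(q+1)`. [cite: Zhang2022LandauSiegel, §16 Lemma 16.2 p.94] -/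
theorem totient_prod_eq (hD : D ≠ 0) :
    ((Nat.totient D : ℂ) / (D : ℂ)) * ∏ q ∈ D.primeFactors, ((q : ℂ) / ((q : ℂ) + 1)) =
      ∏ q ∈ D.primeFactors, (1 - ((q : ℂ) ^ (-(1 : ℂ)))) ^ 2 / (1 - ((q : ℂ) ^ (-(1 : ℂ))) ^ 2) := by
  have h := congrArg (fun r : ℚ => (r : ℂ)) (Nat.totient_eq_mul_prod_factors D)
  simp only [Rat.cast_natCast, Rat.cast_mul, Rat.cast_prod, Rat.cast_sub, Rat.cast_one, Rat.cast_inv] at h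
  have hD' : (D : ℂ) ≠ 0 := by exact_mod_cast hD
  rw [h, mul_div_cancel_left₀ _ hD', ← Finset.prod_mul_distrib]
  refine Finset.prod_congr rfl fun q hq => ?_
  have hqp := Nat.prime_of_mem_primeFactors hq
  have hq0 : (q : ℂ) ≠ 0 := by exact_mod_cast hqp.ne_zero
  have hq1 : (q : ℂ) + 1 ≠ 0 := by
    intro h0; have := congrArg Complex.re h0; simp at this; linarith [(show (0:ℝ) ≤ q from Nat.cast_nonneg q)]
  have hq1m : (q : ℂ) - 1 ≠ 0 := sub_ne_zero.mpr (by exact_mod_cast hqp.one_lt.ne')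
  rw [Complex.cpow_neg_one]
  have e1 : (1 : ℂ) - ((q : ℂ)⁻¹) ^ 2 = (((q : ℂ) - 1) * ((q : ℂ) + 1)) / ((q : ℂ) * (q : ℂ)) := by
    field_simp; ring
  have e2 : (1 : ℂ) - (q : ℂ)⁻¹ = ((q : ℂ) - 1) / (q : ℂ) := by field_simp
  rw [e1, e2]
  field_simp

/-- A finite product over `D.primeFactors` as a product over the corresponding `Finset Nat.Primes`. [folklore] -/
private theorem prod_primeFactors_subtype (D : ℕ) (f : ℕ → ℂ) :
    ∏ q ∈ (D.primeFactors.subtype Nat.Prime : Finset Nat.Primes), f (q : ℕ) = ∏ q ∈ D.primeFactors, f q := by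
  rw [Finset.prod_subtype_eq_prod_filter]
  rw [Finset.filter_true_of_mem fun q hq => Nat.prime_of_mem_primeFactors hq]

/-- **The model factors multiply to Lemma 16.2's main term**: for a real character `χ` mod `D ≥ 1`,
`∏'_q m_q = (6/π²)·φ(D)/(D𝔭)·∏_{q∣D} q/(q+1) = frakU2Main χ`, where `m_q = (1−q⁻¹)²` if `χ(q) = 0`, `m₂ = 3/8` if
`χ(2) = 1`, and `m_q = (1−q⁻²)/M_q` otherwise. [cite: Zhang2022LandauSiegel, §16 Lemma 16.2 p.94] -/
theorem hasProd_model (hD : D ≠ 0) (hχ : χ.IsQuadratic) :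
    HasProd (fun q : Nat.Primes =>
        if χ ((q : ℕ) : ZMod D) = 0 then (1 - ((q : ℕ) : ℂ) ^ (-(1 : ℂ))) ^ 2
        else if ((q : ℕ) = 2 ∧ χ (2 : ZMod D) = 1) then (3 / 8 : ℂ)
        else (1 - (((q : ℕ) : ℂ) ^ (-(1 : ℂ))) ^ 2) / locMain (χ ((q : ℕ) : ZMod D)) (q : ℕ))
      (frakU2Main χ) := by
  classical
  have hfrakp : (1 / 2 : ℝ) ≤ ‖frakp χ‖ := half_le_norm_frakp χ hχ
  have hfrakp0 : frakp χ ≠ 0 := by intro h; rw [h, norm_zero] at hfrakp; norm_num at hfrakp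
  -- the finite `D`-part
  set S : Finset Nat.Primes := D.primeFactors.subtype Nat.Prime with hS
  have hmemS : ∀ q : Nat.Primes, q ∈ S ↔ (q : ℕ) ∣ D := by
    intro q
    have h : q ∈ S ↔ (q : ℕ) ∈ D.primeFactors := Finset.mem_subtype
    rw [h, Nat.mem_primeFactors]
    exact ⟨fun h => h.2.1, fun h => ⟨q.prop, h, hD⟩⟩
  have hzero : ∀ q : Nat.Primes, χ ((q : ℕ) : ZMod D) = 0 ↔ (q : ℕ) ∣ D := by
    intro q
    constructor
    · exact dvd_of_apply_eq_zero χ q.prop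
    · intro hdvd
      have : ¬ IsUnit ((q : ℕ) : ZMod D) := by
        rw [ZMod.isUnit_iff_coprime]
        exact (Nat.Prime.coprime_iff_not_dvd q.prop).not.mpr (not_not.mpr hdvd)
      exact χ.map_nonunit this
  set dD : Nat.Primes → ℂ := fun q => if χ ((q : ℕ) : ZMod D) = 0 then
    (1 - ((q : ℕ) : ℂ) ^ (-(1 : ℂ))) ^ 2 / (1 - (((q : ℕ) : ℂ) ^ (-(1 : ℂ))) ^ 2) else 1 with hdD
  have hdDprod : HasProd dD (∏ q ∈ S, dD q) := by
    refine hasProd_prod_of_ne_finset_one fun q hq => ?_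
    rw [hdD]; dsimp only
    rw [if_neg ((hzero q).not.mpr ((hmemS q).not.mp hq))]
  have hdDval : ∏ q ∈ S, dD q = ((Nat.totient D : ℂ) / (D : ℂ)) * ∏ q ∈ D.primeFactors, ((q : ℂ) / ((q : ℂ) + 1)) := by
    rw [totient_prod_eq hD, hS, ← prod_primeFactors_subtype D (fun q => (1 - ((q : ℂ) ^ (-(1 : ℂ)))) ^ 2 /
      (1 - ((q : ℂ) ^ (-(1 : ℂ))) ^ 2))]
    refine Finset.prod_congr rfl fun q hq => ?_
    rw [hdD]; dsimp only
    rw [if_pos ((hzero q).mpr ((hmemS q).mp (by rw [hS]; exact hq)))]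
  -- nonvanishing of `1 − q⁻²`
  have h1y : ∀ q : Nat.Primes, (1 : ℂ) - (((q : ℕ) : ℂ) ^ (-(1 : ℂ))) ^ 2 ≠ 0 := by
    intro q
    have hq2 : (2 : ℝ) ≤ (q : ℕ) := by exact_mod_cast q.prop.two_le
    have hyn : ‖((q : ℕ) : ℂ) ^ (-(1 : ℂ))‖ = ((q : ℕ) : ℝ)⁻¹ := by
      rw [Complex.norm_natCast_cpow_of_pos q.prop.pos]; simp [Real.rpow_neg_one]
    have hyle : ‖((q : ℕ) : ℂ) ^ (-(1 : ℂ))‖ ≤ 1 / 2 := by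
      rw [hyn]; exact inv_le_of_inv_le₀ (by norm_num) (by linarith)
    intro h0
    have h1 : (((q : ℕ) : ℂ) ^ (-(1 : ℂ))) ^ 2 = 1 := by linear_combination -h0
    have := congrArg norm h1
    rw [norm_pow, norm_one] at this
    nlinarith [norm_nonneg (((q : ℕ) : ℂ) ^ (-(1 : ℂ)))]
  have h6 := hasProd_one_sub_inv_sq
  by_cases h2 : χ (2 : ZMod D) ≠ 1
  · -- Case `χ(2) ≠ 1`: `𝔭 = ∏_q M_q`
    have hp : frakp χ = frakpA χ := by unfold frakp; rw [if_pos h2]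
    obtain ⟨hA, -⟩ := hasProd_frakpFactor χ
    have hA0 : frakpA χ ≠ 0 := hp ▸ hfrakp0
    have hAinv := hasProd_inv_of_ne_zero' hA hA0
    have hall := (h6.mul hdDprod).mul hAinv
    have hval : (((6 / Real.pi ^ 2 : ℝ) : ℂ)) * (∏ q ∈ S, dD q) * (frakpA χ)⁻¹ = frakU2Main χ := by
      rw [hdDval, frakU2Main, hp]; field_simp
    rw [← hval]
    refine hall.congr_fun fun q => ?_
    simp only [hdD]
    have hq := q.prop
    by_cases hz : χ ((q : ℕ) : ZMod D) = 0
    · rw [if_pos hz, if_pos hz, (frakpFactor_facts χ hq).1 hz, inv_one, mul_one, mul_div_cancel₀ _ (h1y q)]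
    · rw [if_neg hz, if_neg hz, if_neg (fun h => h2 h.2), mul_one, frakpFactor_eq_locMain, div_eq_mul_inv]
  · -- Case `χ(2) = 1`: `𝔭 = 2∏_{q>2} M_q`
    rw [not_not] at h2
    have hp : frakp χ = frakpB χ := by unfold frakp; rw [if_neg (not_not.mpr h2)]
    obtain ⟨-, hB⟩ := hasProd_frakpFactor χ
    have hB0 : frakpB χ / 2 ≠ 0 := div_ne_zero (hp ▸ hfrakp0) two_ne_zero
    have hBinv := hasProd_inv_of_ne_zero' hB hB0
    have he : HasProd (fun q : Nat.Primes => if (q : ℕ) = 2 then (1 / 2 : ℂ) else 1) (1 / 2) := by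
      have h := hasProd_single (f := fun q : Nat.Primes => if (q : ℕ) = 2 then (1 / 2 : ℂ) else 1)
        (⟨2, Nat.prime_two⟩ : Nat.Primes) (fun q hq => by
          rw [if_neg]
          intro h2'
          exact hq (Subtype.ext h2'))
      simpa using h
    have hall := ((h6.mul hdDprod).mul he).mul hBinv
    have hval : (((6 / Real.pi ^ 2 : ℝ) : ℂ)) * (∏ q ∈ S, dD q) * (1 / 2) * (frakpB χ / 2)⁻¹ = frakU2Main χ := by
      rw [hdDval, frakU2Main, hp]; field_simp
    rw [← hval]
    refine hall.congr_fun fun q => ?_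
    simp only [hdD]
    have hq := q.prop
    have h2D : χ ((2 : ℕ) : ZMod D) ≠ 0 := by
      have : χ ((2 : ℕ) : ZMod D) = 1 := by simpa using h2
      rw [this]; exact one_ne_zero
    by_cases hq2 : (q : ℕ) = 2
    · have hz : ¬ χ ((q : ℕ) : ZMod D) = 0 := by rw [hq2]; exact h2D
      rw [if_neg hz, if_pos ⟨hq2, h2⟩, if_neg hz, if_pos hq2, if_pos hq2, hq2]
      push_cast
      rw [Complex.cpow_neg_one]; norm_num
    · rw [if_neg hq2, if_neg hq2]
      by_cases hz : χ ((q : ℕ) : ZMod D) = 0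
      · rw [if_pos hz, if_pos hz, (frakpFactor_facts χ hq).1 hz, inv_one, mul_one, mul_one, mul_div_cancel₀ _ (h1y q)]
      · rw [if_neg hz, if_neg hz, if_neg (fun h => hq2 h.1), mul_one, mul_one, frakpFactor_eq_locMain, div_eq_mul_inv]

end ModelProduct

/-! ## §2. The Euler factor at `s = 1` against the model factor, prime by prime -/

section PerPrime

variable (c' : ℝ) {D : ℕ} [NeZero D] (χ : DirichletCharacter ℂ D) (j : ℕ)

/-- **`‖Φ_q(1) − m_q‖ ≤ 2.5·10¹⁰·δ_q/q` for every prime `q`** (under `χ` quadratic, `𝓜₂*(1−β_j) ≠ 0`, and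
`‖F_q(1,1;1−β_j)‖ ≥ 1/2` at every prime except `q = 2` when `χ(2) = 1`): exact at the primes with `χ(q) = 0`
(`Phi_eq_of_apply_eq_zero`), `norm_Phi_two_one_sub_model_le` at `2` when `χ(2) = 1`, and
`norm_Phi_one_sub_model_le` + `Phi_model_eq_*` otherwise. [cite: Zhang2022LandauSiegel, §16 Lemma 16.2 p.94] -/
theorem norm_Phi_one_sub_model_all (hχ : χ.IsQuadratic) (hstar : calM2star c' χ (1 - betaJ c' D j) ≠ 0)
    (hF : ∀ q : ℕ, q.Prime → (q ≠ 2 ∨ χ (2 : ZMod D) ≠ 1) → 1 / 2 ≤ ‖calM2Factor c' χ q 1 1 (1 - betaJ c' D j)‖)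
    (q : Nat.Primes) :
    ‖(1 - ((q : ℕ) : ℂ) ^ (-(1 : ℂ))) ^ 2 * (1 - ((q : ℕ) : ℂ) ^ betaJ c' D j * ((q : ℕ) : ℂ) ^ (-(1 : ℂ))) *
            (1 - χ ((q : ℕ) : ZMod D) * ((q : ℕ) : ℂ) ^ (-(1 : ℂ))) *
              (1 - χ ((q : ℕ) : ZMod D) * (((q : ℕ) : ℂ) ^ betaJ c' D j * ((q : ℕ) : ℂ) ^ (-(1 : ℂ)))) ^ 2 *
          (if (q : ℕ) = 2 then ∑' e : ℕ, varpi2 c' χ j (2 ^ e) * nuConvChi χ (2 ^ e) * ((2 : ℂ) ^ (-(1 : ℂ))) ^ e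
            else ∑' e : ℕ, varpi2loc c' χ j ((q : ℕ) ^ e) * nuConvChi χ ((q : ℕ) ^ e) * (((q : ℕ) : ℂ) ^ (-(1 : ℂ))) ^ e) -
        (if χ ((q : ℕ) : ZMod D) = 0 then (1 - ((q : ℕ) : ℂ) ^ (-(1 : ℂ))) ^ 2
          else if ((q : ℕ) = 2 ∧ χ (2 : ZMod D) = 1) then (3 / 8 : ℂ)
          else (1 - (((q : ℕ) : ℂ) ^ (-(1 : ℂ))) ^ 2) / locMain (χ ((q : ℕ) : ZMod D)) (q : ℕ))‖
      ≤ 25000000000 * (‖((q : ℕ) : ℂ) ^ (-beta1 c' D) - 1‖ + ‖((q : ℕ) : ℂ) ^ betaJ c' D j - 1‖) / (q : ℕ) := by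
  have hq : (q : ℕ).Prime := q.prop
  have hq0 : (0 : ℝ) < (q : ℕ) := by exact_mod_cast hq.pos
  have hδ0 : 0 ≤ ‖((q : ℕ) : ℂ) ^ (-beta1 c' D) - 1‖ + ‖((q : ℕ) : ℂ) ^ betaJ c' D j - 1‖ := by positivity
  have hs1 : 0 < (1 : ℂ).re := by norm_num
  -- the series at `2`, when `χ(2) ≠ 1`, is the local one
  have hT2 : χ (2 : ZMod D) ≠ 1 → (∑' e : ℕ, varpi2 c' χ j (2 ^ e) * nuConvChi χ (2 ^ e) * ((2 : ℂ) ^ (-(1 : ℂ))) ^ e) =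
      ∑' e : ℕ, varpi2loc c' χ j (2 ^ e) * nuConvChi χ (2 ^ e) * (((2 : ℕ) : ℂ) ^ (-(1 : ℂ))) ^ e := by
    intro h2
    refine tsum_congr fun e => ?_
    rw [varpi2_two_pow_eq_varpi2loc c' χ j hstar h2 e]; push_cast; rfl
  by_cases hz : χ ((q : ℕ) : ZMod D) = 0
  · -- `χ(q) = 0`: exact
    rw [if_pos hz]
    have h2' : (q : ℕ) ≠ 2 ∨ χ (2 : ZMod D) ≠ 1 := by
      by_cases hq2 : (q : ℕ) = 2
      · right; have : χ ((2 : ℕ) : ZMod D) = 0 := by rw [← hq2]; exact hz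
        simp at this; rw [this]; exact zero_ne_one
      · left; exact hq2
    have hFq := hF q hq h2'
    have hF0 : calM2Factor c' χ q 1 1 (1 - betaJ c' D j) ≠ 0 := by
      intro h; rw [h, norm_zero] at hFq; linarith
    have key := Phi_eq_of_apply_eq_zero c' χ j hq hz hF0 hs1
    by_cases hq2 : (q : ℕ) = 2
    · have h2 : χ (2 : ZMod D) ≠ 1 := by
        rcases h2' with h | h
        · exact absurd hq2 h
        · exact h
      rw [if_pos hq2, hT2 h2]
      have key2 := Phi_eq_of_apply_eq_zero c' χ j Nat.prime_two (by have := hz; rwa [hq2] at this)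
        (by have := hF0; rwa [hq2] at this) hs1
      have e2 : ((q : ℕ) : ℂ) = ((2 : ℕ) : ℂ) := by rw [hq2]
      have e2' : ((q : ℕ) : ZMod D) = ((2 : ℕ) : ZMod D) := by rw [hq2]
      rw [e2, e2', key2, sub_self, norm_zero]
      positivity
    · rw [if_neg hq2, key, sub_self, norm_zero]
      positivity
  rw [if_neg hz]
  by_cases hsp : ((q : ℕ) = 2 ∧ χ (2 : ZMod D) = 1)
  · -- the special prime `2` with `χ(2) = 1`
    rw [if_pos hsp, if_pos hsp.1]
    have h := norm_Phi_two_one_sub_model_le c' χ j hstar hsp.2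
    have e2 : ((q : ℕ) : ℂ) = (2 : ℂ) := by rw [hsp.1]; norm_num
    have e2' : ((q : ℕ) : ZMod D) = (2 : ZMod D) := by rw [hsp.1]; norm_num
    rw [e2, e2']
    refine h.trans ?_
    rw [hsp.1]; push_cast
    rw [le_div_iff₀ (by norm_num : (0:ℝ) < 2)]
    nlinarith [norm_nonneg ((2 : ℂ) ^ (-beta1 c' D) - 1), norm_nonneg ((2 : ℂ) ^ betaJ c' D j - 1)]
  · rw [if_neg hsp]
    have hv : χ ((q : ℕ) : ZMod D) = 0 ∨ χ ((q : ℕ) : ZMod D) = 1 ∨ χ ((q : ℕ) : ZMod D) = -1 := hχ _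
    have h2imp : (q : ℕ) = 2 → χ (2 : ZMod D) ≠ 1 := fun h h1 => hsp ⟨h, h1⟩
    have h2' : (q : ℕ) ≠ 2 ∨ χ (2 : ZMod D) ≠ 1 := by
      by_cases hq2 : (q : ℕ) = 2
      · exact Or.inr (h2imp hq2)
      · exact Or.inl hq2
    have hFq := hF q hq h2'
    obtain ⟨-, hmain⟩ := norm_Phi_one_sub_model_le c' χ j hq hv h2imp hFq
    have hmodel : (1 - ((q : ℕ) : ℂ) ^ (-(1 : ℂ))) ^ 2 * (1 - 1 * ((q : ℕ) : ℂ) ^ (-(1 : ℂ))) *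
        (1 - χ ((q : ℕ) : ZMod D) * ((q : ℕ) : ℂ) ^ (-(1 : ℂ))) * (1 - χ ((q : ℕ) : ZMod D) * (1 * ((q : ℕ) : ℂ) ^ (-(1 : ℂ)))) ^ 2 *
        (∑' e : ℕ, (∑ i ∈ Finset.range (e + 1), χ ((q : ℕ) : ZMod D) ^ (e - i) *
          ((1 - (if Nat.Coprime (q : ℕ) ((q : ℕ) ^ (e - i)) then (1 : ℂ) else 0) * (χ ((q : ℕ) : ZMod D) / (((q : ℕ) : ℂ) - 1))) /
            (1 - 1 * (χ ((q : ℕ) : ZMod D) / (((q : ℕ) : ℂ) - 1))))) * nuConvChi χ ((q : ℕ) ^ e) * (((q : ℕ) : ℂ) ^ (-(1 : ℂ))) ^ e)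
        = (1 - (((q : ℕ) : ℂ) ^ (-(1 : ℂ))) ^ 2) / locMain (χ ((q : ℕ) : ZMod D)) (q : ℕ) := by
      rcases hv with h | h | h
      · exact absurd h hz
      · have hq3 : 3 ≤ (q : ℕ) := by
          have hne : (q : ℕ) ≠ 2 := fun h2 => hsp ⟨h2, by have := h; rw [h2] at this; simpa using this⟩
          have := hq.two_le; omega
        exact Phi_model_eq_of_apply_eq_one χ hq h hq3
      · exact Phi_model_eq_of_apply_eq_neg_one χ hq h
    rw [← hmodel]
    by_cases hq2 : (q : ℕ) = 2
    · rw [if_pos hq2, hT2 (h2imp hq2)]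
      have e2 : ((q : ℕ) : ℂ) = ((2 : ℕ) : ℂ) := by rw [hq2]
      rw [e2] at hmain ⊢
      have : (2 : ℕ) ^ 1 = 2 := rfl
      simpa only [hq2] using hmain
    · rw [if_neg hq2]; exact hmain

/-- **The tail bound**: for a prime `q ≥ 700` with `χ(q) = ±1`,
`‖Φ_q(1) − m_q‖ ≤ ‖Φ_q(1) − 1‖ + ‖m_q − 1‖ ≤ 30008508·q^{−9/5}` (`norm_Phi_sub_one_le` at `s = 1`,
`‖M_q − 1‖ ≤ 4/q²`). [cite: Zhang2022LandauSiegel, §16 Lemma 16.2 p.94, App. A p.105] -/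
theorem norm_Phi_one_sub_model_tail {q : ℕ} (hq : q.Prime) (h700 : 700 ≤ q)
    (hv : χ (q : ZMod D) = 1 ∨ χ (q : ZMod D) = -1) :
    ‖(1 - (q : ℂ) ^ (-(1 : ℂ))) ^ 2 * (1 - (q : ℂ) ^ betaJ c' D j * (q : ℂ) ^ (-(1 : ℂ))) *
            (1 - χ (q : ZMod D) * (q : ℂ) ^ (-(1 : ℂ))) * (1 - χ (q : ZMod D) * ((q : ℂ) ^ betaJ c' D j * (q : ℂ) ^ (-(1 : ℂ)))) ^ 2 *
          (∑' e : ℕ, varpi2loc c' χ j (q ^ e) * nuConvChi χ (q ^ e) * ((q : ℂ) ^ (-(1 : ℂ))) ^ e) -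
        (1 - ((q : ℂ) ^ (-(1 : ℂ))) ^ 2) / locMain (χ (q : ZMod D)) q‖ ≤ 30008508 * (q : ℝ) ^ (-(9 / 5 : ℝ)) := by
  have hq0 : (0 : ℝ) < q := by exact_mod_cast hq.pos
  have hq1 : (1 : ℝ) ≤ q := by exact_mod_cast hq.one_lt.le
  have hs : 9 / 10 < (1 : ℂ).re := by norm_num
  have h1 := norm_Phi_sub_one_le c' χ j hq h700 hv hs
  obtain ⟨hx1, hx2⟩ := norm_x_bounds hq hs
  -- the model is `1 + O(q⁻²)`
  have hvn : ‖χ (q : ZMod D)‖ ≤ 1 := χ.norm_le_one _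
  have hM1 := norm_locMain_sub_one_le hvn hq.two_le
  have hM34 : 3 / 4 ≤ ‖locMain (χ (q : ZMod D)) q‖ := by
    refine norm_locMain_ge hq ?_ (fun h2 => by omega)
    rcases hv with h | h
    · exact Or.inr (Or.inl h)
    · exact Or.inr (Or.inr h)
  have hM0 : locMain (χ (q : ZMod D)) q ≠ 0 := by intro h; rw [h, norm_zero] at hM34; linarith
  have hy2 : ‖((q : ℂ) ^ (-(1 : ℂ))) ^ 2‖ = ((q : ℝ) ^ 2)⁻¹ := by
    rw [norm_pow, Complex.norm_natCast_cpow_of_pos hq.pos]; simp [Real.rpow_neg_one, inv_pow]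
  have hm1 : ‖(1 - ((q : ℂ) ^ (-(1 : ℂ))) ^ 2) / locMain (χ (q : ZMod D)) q - 1‖ ≤ 8 / (q : ℝ) ^ 2 := by
    rw [div_sub_one hM0, norm_div, div_le_div_iff₀ (by linarith) (by positivity)]
    have : ‖1 - ((q : ℂ) ^ (-(1 : ℂ))) ^ 2 - locMain (χ (q : ZMod D)) q‖ ≤ 5 / (q : ℝ) ^ 2 := by
      rw [show 1 - ((q : ℂ) ^ (-(1 : ℂ))) ^ 2 - locMain (χ (q : ZMod D)) q =
        -(((q : ℂ) ^ (-(1 : ℂ))) ^ 2) - (locMain (χ (q : ZMod D)) q - 1) by ring]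
      calc _ ≤ ‖-(((q : ℂ) ^ (-(1 : ℂ))) ^ 2)‖ + ‖locMain (χ (q : ZMod D)) q - 1‖ := norm_sub_le _ _
        _ ≤ ((q : ℝ) ^ 2)⁻¹ + 4 / (q : ℝ) ^ 2 := by rw [norm_neg, hy2]; exact add_le_add le_rfl hM1
        _ = 5 / (q : ℝ) ^ 2 := by ring
    calc _ ≤ 5 / (q : ℝ) ^ 2 * (q : ℝ) ^ 2 := by gcongr
      _ = 5 := by field_simp
      _ ≤ 8 * ‖locMain (χ (q : ZMod D)) q‖ := by linarith
  have h8 : 8 / (q : ℝ) ^ 2 ≤ 8 * (q : ℝ) ^ (-(9 / 5 : ℝ)) := by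
    have e : (8 : ℝ) / (q : ℝ) ^ 2 = 8 * (q : ℝ) ^ (-(2 : ℝ)) := by
      rw [Real.rpow_neg hq0.le, Real.rpow_two, div_eq_mul_inv]
    rw [e]
    exact mul_le_mul_of_nonneg_left (Real.rpow_le_rpow_of_exponent_le hq1 (by norm_num)) (by norm_num)
  calc _ ≤ ‖(1 - (q : ℂ) ^ (-(1 : ℂ))) ^ 2 * (1 - (q : ℂ) ^ betaJ c' D j * (q : ℂ) ^ (-(1 : ℂ))) *
            (1 - χ (q : ZMod D) * (q : ℂ) ^ (-(1 : ℂ))) * (1 - χ (q : ZMod D) * ((q : ℂ) ^ betaJ c' D j * (q : ℂ) ^ (-(1 : ℂ)))) ^ 2 *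
          (∑' e : ℕ, varpi2loc c' χ j (q ^ e) * nuConvChi χ (q ^ e) * ((q : ℂ) ^ (-(1 : ℂ))) ^ e) - 1‖ +
        ‖(1 : ℂ) - (1 - ((q : ℂ) ^ (-(1 : ℂ))) ^ 2) / locMain (χ (q : ZMod D)) q‖ := norm_sub_le_norm_sub_add_norm_sub _ _ _
    _ ≤ (8500 * ‖(q : ℂ) ^ (-(1 : ℂ))‖ / q + 30000000 * ‖(q : ℂ) ^ (-(1 : ℂ))‖ ^ 2) + 8 / (q : ℝ) ^ 2 := by
        rw [norm_sub_rev (1 : ℂ)]; exact add_le_add h1 hm1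
    _ ≤ (8500 * (q : ℝ) ^ (-(9 / 5 : ℝ)) + 30000000 * (q : ℝ) ^ (-(9 / 5 : ℝ))) + 8 * (q : ℝ) ^ (-(9 / 5 : ℝ)) := by
        rw [mul_div_assoc]; gcongr
    _ = 30008508 * (q : ℝ) ^ (-(9 / 5 : ℝ)) := by ring

end PerPrime

/-! ## §3. Summation lemmas over the primes -/

section PrimeSums

/-- A finite sum over the `Finset {p // p.Prime}` of primes `≤ Q` is the sum over `Nat.primesLE Q` (plumbing). [folklore] -/
private theorem sum_primesLE_subtype_eq (Q : ℕ) (f : ℕ → ℝ) :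
    ∑ q ∈ (Nat.primesLE Q).subtype Nat.Prime, f (q : ℕ) = ∑ q ∈ Nat.primesLE Q, f q := by
  rw [Finset.sum_subtype_eq_sum_filter]
  rw [Finset.filter_true_of_mem fun q hq => (Nat.mem_primesLE.mp hq).2]

/-- `Σ_{q ≤ Q prime} log q / q ≤ log Q + log 4` as a `tsum` over `Nat.Primes` (Mertens, tree
`MertensBound.sum_log_div_prime_le`). [cite: Zhang2022LandauSiegel, §16 Lemma 16.2 p.94] -/
theorem tsum_indicator_log_div_le (Q : ℕ) :
    (Summable fun q : Nat.Primes => if (q : ℕ) ≤ Q then Real.log (q : ℕ) / (q : ℕ) else (0 : ℝ)) ∧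
      ∑' q : Nat.Primes, (if (q : ℕ) ≤ Q then Real.log (q : ℕ) / (q : ℕ) else (0 : ℝ)) ≤ Real.log Q + Real.log 4 := by
  classical
  set S : Finset Nat.Primes := (Nat.primesLE Q).subtype Nat.Prime with hS
  have hmem : ∀ q : Nat.Primes, q ∈ S ↔ (q : ℕ) ≤ Q := by
    intro q
    have h : q ∈ S ↔ (q : ℕ) ∈ Nat.primesLE Q := Finset.mem_subtype
    rw [h, Nat.mem_primesLE]
    exact ⟨fun h => h.1, fun h => ⟨h, q.prop⟩⟩
  have hzero : ∀ q : Nat.Primes, q ∉ S → (if (q : ℕ) ≤ Q then Real.log (q : ℕ) / (q : ℕ) else (0 : ℝ)) = 0 := by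
    intro q hq; rw [if_neg ((hmem q).not.mp hq)]
  refine ⟨summable_of_ne_finset_zero hzero, ?_⟩
  rw [tsum_eq_sum hzero]
  have h1 : ∑ q ∈ S, (if (q : ℕ) ≤ Q then Real.log (q : ℕ) / (q : ℕ) else (0 : ℝ)) =
      ∑ q ∈ S, Real.log (q : ℕ) / (q : ℕ) := Finset.sum_congr rfl fun q hq => by rw [if_pos ((hmem q).mp hq)]
  have h2 : ∑ q ∈ S, Real.log (q : ℕ) / (q : ℕ) = ∑ q ∈ Nat.primesLE Q, Real.log q / q :=
    sum_primesLE_subtype_eq Q (fun q => Real.log q / q)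
  rw [h1, h2]
  exact Literature.NumberTheory.LFunctions.MertensBound.sum_log_div_prime_le Q

/-- `Σ_q 𝟙[q < 700] ≤ 700` over the primes. [folklore] -/
private theorem tsum_indicator_lt_le :
    (Summable fun q : Nat.Primes => if (q : ℕ) < 700 then (1 : ℝ) else 0) ∧
      ∑' q : Nat.Primes, (if (q : ℕ) < 700 then (1 : ℝ) else 0) ≤ 700 := by
  classical
  set S : Finset Nat.Primes := (Finset.range 700).subtype Nat.Prime with hS
  have hmem : ∀ q : Nat.Primes, q ∈ S ↔ (q : ℕ) < 700 := by
    intro q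
    have h : q ∈ S ↔ (q : ℕ) ∈ Finset.range 700 := Finset.mem_subtype
    rw [h, Finset.mem_range]
  have hzero : ∀ q : Nat.Primes, q ∉ S → (if (q : ℕ) < 700 then (1 : ℝ) else 0) = 0 := by
    intro q hq; rw [if_neg ((hmem q).not.mp hq)]
  refine ⟨summable_of_ne_finset_zero hzero, ?_⟩
  rw [tsum_eq_sum hzero]
  have hcard : S.card ≤ 700 := by
    have h1 : S.card = ((Finset.range 700).filter Nat.Prime).card := Finset.card_subtype _ _
    rw [h1]
    exact (Finset.card_filter_le _ _).trans (by rw [Finset.card_range])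
  have h1 : ∑ q ∈ S, (if (q : ℕ) < 700 then (1 : ℝ) else 0) ≤ ∑ q ∈ S, (1 : ℝ) :=
    Finset.sum_le_sum fun q _ => by split_ifs <;> norm_num
  have h2 : ∑ q ∈ S, (1 : ℝ) = S.card := by rw [Finset.sum_const, nsmul_eq_mul, mul_one]
  have h3 : (S.card : ℝ) ≤ 700 := by exact_mod_cast hcard
  linarith

end PrimeSums

/-! ## §4. The value `E₂ⱼ(1)`: `‖∏'_q Φ_q(1) − frakU2Main χ‖ ≤ K·(η(log Q + 2) + (Q+1)^{−7/10})` -/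

section Value

variable (c' : ℝ)

/-- The model factor is `1 + O(q⁻²)`: `‖m_q − 1‖ ≤ 8/q²` for `χ(q) = ±1` (not `q = 2 ∧ χ(2) = 1`).
[cite: Zhang2022LandauSiegel, §16 Lemma 16.2 p.94] -/
theorem norm_model_sub_one_le {D : ℕ} (χ : DirichletCharacter ℂ D) {q : ℕ} (hq : q.Prime)
    (hv : χ (q : ZMod D) = 1 ∨ χ (q : ZMod D) = -1) (h2 : q = 2 → χ (q : ZMod D) ≠ 1) :
    ‖(1 - ((q : ℂ) ^ (-(1 : ℂ))) ^ 2) / locMain (χ (q : ZMod D)) q - 1‖ ≤ 8 / (q : ℝ) ^ 2 := by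
  have hq0 : (0 : ℝ) < q := by exact_mod_cast hq.pos
  have hvn : ‖χ (q : ZMod D)‖ ≤ 1 := χ.norm_le_one _
  have hM1 := norm_locMain_sub_one_le hvn hq.two_le
  have hM34 : 3 / 4 ≤ ‖locMain (χ (q : ZMod D)) q‖ := by
    refine norm_locMain_ge hq ?_ h2
    rcases hv with h | h
    · exact Or.inr (Or.inl h)
    · exact Or.inr (Or.inr h)
  have hM0 : locMain (χ (q : ZMod D)) q ≠ 0 := by intro h; rw [h, norm_zero] at hM34; linarith
  have hy2 : ‖((q : ℂ) ^ (-(1 : ℂ))) ^ 2‖ = ((q : ℝ) ^ 2)⁻¹ := by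
    rw [norm_pow, Complex.norm_natCast_cpow_of_pos hq.pos]; simp [Real.rpow_neg_one, inv_pow]
  rw [div_sub_one hM0, norm_div, div_le_div_iff₀ (by linarith) (by positivity)]
  have : ‖1 - ((q : ℂ) ^ (-(1 : ℂ))) ^ 2 - locMain (χ (q : ZMod D)) q‖ ≤ 5 / (q : ℝ) ^ 2 := by
    rw [show 1 - ((q : ℂ) ^ (-(1 : ℂ))) ^ 2 - locMain (χ (q : ZMod D)) q =
      -(((q : ℂ) ^ (-(1 : ℂ))) ^ 2) - (locMain (χ (q : ZMod D)) q - 1) by ring]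
    calc _ ≤ ‖-(((q : ℂ) ^ (-(1 : ℂ))) ^ 2)‖ + ‖locMain (χ (q : ZMod D)) q - 1‖ := norm_sub_le _ _
      _ ≤ ((q : ℝ) ^ 2)⁻¹ + 4 / (q : ℝ) ^ 2 := by rw [norm_neg, hy2]; exact add_le_add le_rfl hM1
      _ = 5 / (q : ℝ) ^ 2 := by ring
  calc _ ≤ 5 / (q : ℝ) ^ 2 * (q : ℝ) ^ 2 := by gcongr
    _ = 5 := by field_simp
    _ ≤ 8 * ‖locMain (χ (q : ZMod D)) q‖ := by linarith

end Value

/-! ## §5. The value estimate -/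

section ValueMain

variable (c' : ℝ)

/-- At a prime with `χ(q) = 0` the Euler factor of `E₂ⱼ` at `s = 1` IS the model factor `(1 − q⁻¹)²`
(also at `q = 2`, where the global coefficients coincide with the local ones since `χ(2) = 0 ≠ 1`).
[cite: Zhang2022LandauSiegel, §16 Lemma 16.2 p.94] -/
theorem Phi_one_eq_model_of_apply_eq_zero {D : ℕ} [NeZero D] (χ : DirichletCharacter ℂ D) (j : ℕ)
    (hstar : calM2star c' χ (1 - betaJ c' D j) ≠ 0)
    (hF : ∀ q : ℕ, q.Prime → (q ≠ 2 ∨ χ (2 : ZMod D) ≠ 1) → 1 / 2 ≤ ‖calM2Factor c' χ q 1 1 (1 - betaJ c' D j)‖)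
    (q : Nat.Primes) (hz : χ ((q : ℕ) : ZMod D) = 0) :
    (1 - ((q : ℕ) : ℂ) ^ (-(1 : ℂ))) ^ 2 * (1 - ((q : ℕ) : ℂ) ^ betaJ c' D j * ((q : ℕ) : ℂ) ^ (-(1 : ℂ))) *
            (1 - χ ((q : ℕ) : ZMod D) * ((q : ℕ) : ℂ) ^ (-(1 : ℂ))) *
              (1 - χ ((q : ℕ) : ZMod D) * (((q : ℕ) : ℂ) ^ betaJ c' D j * ((q : ℕ) : ℂ) ^ (-(1 : ℂ)))) ^ 2 *
          (if (q : ℕ) = 2 then ∑' e : ℕ, varpi2 c' χ j (2 ^ e) * nuConvChi χ (2 ^ e) * ((2 : ℂ) ^ (-(1 : ℂ))) ^ e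
            else ∑' e : ℕ, varpi2loc c' χ j ((q : ℕ) ^ e) * nuConvChi χ ((q : ℕ) ^ e) * (((q : ℕ) : ℂ) ^ (-(1 : ℂ))) ^ e)
      = (1 - ((q : ℕ) : ℂ) ^ (-(1 : ℂ))) ^ 2 := by
  have hq : (q : ℕ).Prime := q.prop
  have hs1 : 0 < (1 : ℂ).re := by norm_num
  have h2' : (q : ℕ) ≠ 2 ∨ χ (2 : ZMod D) ≠ 1 := by
    by_cases hq2 : (q : ℕ) = 2
    · right; have : χ ((2 : ℕ) : ZMod D) = 0 := by rw [← hq2]; exact hz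
      simp at this; rw [this]; exact zero_ne_one
    · left; exact hq2
  have hFq := hF q hq h2'
  have hF0 : calM2Factor c' χ q 1 1 (1 - betaJ c' D j) ≠ 0 := by
    intro h; rw [h, norm_zero] at hFq; linarith
  by_cases hq2 : (q : ℕ) = 2
  · have h2 : χ (2 : ZMod D) ≠ 1 := by
      rcases h2' with h | h
      · exact absurd hq2 h
      · exact h
    have hT2 : (∑' e : ℕ, varpi2 c' χ j (2 ^ e) * nuConvChi χ (2 ^ e) * ((2 : ℂ) ^ (-(1 : ℂ))) ^ e) =
        ∑' e : ℕ, varpi2loc c' χ j (2 ^ e) * nuConvChi χ (2 ^ e) * (((2 : ℕ) : ℂ) ^ (-(1 : ℂ))) ^ e := by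
      refine tsum_congr fun e => ?_
      rw [varpi2_two_pow_eq_varpi2loc c' χ j hstar h2 e]; push_cast; rfl
    rw [if_pos hq2, hT2]
    have key2 := Phi_eq_of_apply_eq_zero c' χ j Nat.prime_two (by have := hz; rwa [hq2] at this)
      (by have := hF0; rwa [hq2] at this) hs1
    have e2 : ((q : ℕ) : ℂ) = ((2 : ℕ) : ℂ) := by rw [hq2]
    have e2' : ((q : ℕ) : ZMod D) = ((2 : ℕ) : ZMod D) := by rw [hq2]
    rw [e2, e2', key2]
  · rw [if_neg hq2]
    exact Phi_eq_of_apply_eq_zero c' χ j hq hz hF0 hs1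

/-- The final real-arithmetic step. [folklore] -/
private theorem real_final_bound {E η L T S : ℝ} (hE : 0 ≤ E) (hη : 0 ≤ η) (hL : 0 ≤ L) (hT : 0 ≤ T)
    (hS : 0 ≤ S) (hlog4 : Real.log 4 ≤ 2) :
    E * (25000000000 * η * (L + Real.log 4) + 30008508 * T * S) ≤
      E * (25000000000 + 30008508 * S) * (η * (L + 2) + T) := by
  have h1 : 25000000000 * η * (L + Real.log 4) ≤ 25000000000 * (η * (L + 2)) := by nlinarith [mul_nonneg hη hL]
  have hηL : 0 ≤ η * (L + 2) := by positivity
  have h2 : 25000000000 * (η * (L + 2)) + 30008508 * T * S ≤ (25000000000 + 30008508 * S) * (η * (L + 2) + T) := by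
    nlinarith [mul_nonneg hS hηL, mul_nonneg hT hS, mul_nonneg hT (show (0:ℝ) ≤ 25000000000 by norm_num)]
  calc _ ≤ E * (25000000000 * (η * (L + 2)) + 30008508 * T * S) := by gcongr
    _ ≤ E * ((25000000000 + 30008508 * S) * (η * (L + 2) + T)) := by gcongr
    _ = _ := by ring

set_option maxHeartbeats 1600000 in
/-- **Clause (iv) of `Lemma162R`, quantitative**: there is an absolute `K` such that, for every modulus `D`,
real character `χ`, index `j` with `𝓜₂*(1−β_j) ≠ 0` and `‖F_q(1,1;1−β_j)‖ ≥ 1/2` (all primes, except `2` when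
`χ(2) = 1`), every `η ≥ 0` with `‖q^{−β₁} − 1‖ + ‖q^{β_j} − 1‖ ≤ η log q` (all primes) and every `Q ≥ 700`:
`‖∏'_q Φ_q(1) − frakU2Main χ‖ ≤ K·(η(log Q + 2) + (Q+1)^{−7/10})`. Mechanism: `Φ_q(1) = m_q` at `q ∣ D`;
elsewhere `|Φ_q(1) − m_q| ≤ 2.5·10¹⁰δ_q/q` (summed with Mertens up to `Q`) and `≤ 3·10⁷q^{−9/5}` (summed beyond `Q`);
product comparison `AppendixA.norm_tprod_one_add_sub_tprod_one_add_le`.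
[cite: Zhang2022LandauSiegel, §16 Lemma 16.2 p.94, App. A p.106] -/
theorem norm_tprod_Phi_one_sub_frakU2Main_le :
    ∃ K : ℝ, 0 ≤ K ∧ ∀ {D : ℕ} [NeZero D] (χ : DirichletCharacter ℂ D) (j : ℕ), χ.IsQuadratic →
      calM2star c' χ (1 - betaJ c' D j) ≠ 0 →
      (∀ q : ℕ, q.Prime → (q ≠ 2 ∨ χ (2 : ZMod D) ≠ 1) → 1 / 2 ≤ ‖calM2Factor c' χ q 1 1 (1 - betaJ c' D j)‖) →
      ∀ (η : ℝ), 0 ≤ η →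
        (∀ q : ℕ, q.Prime → ‖(q : ℂ) ^ (-beta1 c' D) - 1‖ + ‖(q : ℂ) ^ betaJ c' D j - 1‖ ≤ η * Real.log q) →
        ∀ (Q : ℕ), 700 ≤ Q →
          ‖(∏' q : Nat.Primes,
              (1 - ((q : ℕ) : ℂ) ^ (-(1 : ℂ))) ^ 2 * (1 - ((q : ℕ) : ℂ) ^ betaJ c' D j * ((q : ℕ) : ℂ) ^ (-(1 : ℂ))) *
                  (1 - χ ((q : ℕ) : ZMod D) * ((q : ℕ) : ℂ) ^ (-(1 : ℂ))) *
                    (1 - χ ((q : ℕ) : ZMod D) * (((q : ℕ) : ℂ) ^ betaJ c' D j * ((q : ℕ) : ℂ) ^ (-(1 : ℂ)))) ^ 2 *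
                (if (q : ℕ) = 2 then ∑' e : ℕ, varpi2 c' χ j (2 ^ e) * nuConvChi χ (2 ^ e) * ((2 : ℂ) ^ (-(1 : ℂ))) ^ e
                  else ∑' e : ℕ, varpi2loc c' χ j ((q : ℕ) ^ e) * nuConvChi χ ((q : ℕ) ^ e) *
                    (((q : ℕ) : ℂ) ^ (-(1 : ℂ))) ^ e)) - frakU2Main χ‖
            ≤ K * (η * (Real.log Q + 2) + ((Q : ℝ) + 1) ^ (-(7 / 10 : ℝ))) := by
  classical
  -- absolute constants
  set S95 : ℝ := ∑' q : Nat.Primes, ((q : ℕ) : ℝ) ^ (-(9 / 5 : ℝ)) with hS95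
  set S11 : ℝ := ∑' q : Nat.Primes, ((q : ℕ) : ℝ) ^ (-(11 / 10 : ℝ)) with hS11
  have hs95 : Summable fun q : Nat.Primes => ((q : ℕ) : ℝ) ^ (-(9 / 5 : ℝ)) := Nat.Primes.summable_rpow.mpr (by norm_num)
  have hs11 : Summable fun q : Nat.Primes => ((q : ℕ) : ℝ) ^ (-(11 / 10 : ℝ)) := Nat.Primes.summable_rpow.mpr (by norm_num)
  have hS95n : 0 ≤ S95 := tsum_nonneg fun q => by positivity
  have hS11n : 0 ≤ S11 := tsum_nonneg fun q => by positivity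
  set A0 : ℝ := 8568001 * 700 + 30008508 * S95 with hA0
  set K : ℝ := Real.exp (A0 + 8 * S95) * (25000000000 + 30008508 * S11) with hK
  refine ⟨K, by positivity, ?_⟩
  intro D _ χ j hχ hstar hF η hη hδ Q hQ
  -- notation
  set P : Nat.Primes → ℂ := fun q =>
    (1 - ((q : ℕ) : ℂ) ^ (-(1 : ℂ))) ^ 2 * (1 - ((q : ℕ) : ℂ) ^ betaJ c' D j * ((q : ℕ) : ℂ) ^ (-(1 : ℂ))) *
        (1 - χ ((q : ℕ) : ZMod D) * ((q : ℕ) : ℂ) ^ (-(1 : ℂ))) *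
          (1 - χ ((q : ℕ) : ZMod D) * (((q : ℕ) : ℂ) ^ betaJ c' D j * ((q : ℕ) : ℂ) ^ (-(1 : ℂ)))) ^ 2 *
      (if (q : ℕ) = 2 then ∑' e : ℕ, varpi2 c' χ j (2 ^ e) * nuConvChi χ (2 ^ e) * ((2 : ℂ) ^ (-(1 : ℂ))) ^ e
        else ∑' e : ℕ, varpi2loc c' χ j ((q : ℕ) ^ e) * nuConvChi χ ((q : ℕ) ^ e) * (((q : ℕ) : ℂ) ^ (-(1 : ℂ))) ^ e)
    with hPdef
  set m : Nat.Primes → ℂ := fun q =>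
    if χ ((q : ℕ) : ZMod D) = 0 then (1 - ((q : ℕ) : ℂ) ^ (-(1 : ℂ))) ^ 2
    else if ((q : ℕ) = 2 ∧ χ (2 : ZMod D) = 1) then (3 / 8 : ℂ)
    else (1 - (((q : ℕ) : ℂ) ^ (-(1 : ℂ))) ^ 2) / locMain (χ ((q : ℕ) : ZMod D)) (q : ℕ) with hmdef
  set d : Nat.Primes → ℂ := fun q => if χ ((q : ℕ) : ZMod D) = 0 then (1 - ((q : ℕ) : ℂ) ^ (-(1 : ℂ))) ^ 2 else 1 with hddef
  set P' : Nat.Primes → ℂ := fun q => if χ ((q : ℕ) : ZMod D) = 0 then 1 else P q with hP'def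
  set m' : Nat.Primes → ℂ := fun q => if χ ((q : ℕ) : ZMod D) = 0 then 1 else m q with hm'def
  show ‖∏' q, P q - frakU2Main χ‖ ≤ K * (η * (Real.log Q + 2) + ((Q : ℝ) + 1) ^ (-(7 / 10 : ℝ)))
  -- per-prime facts
  have hPeq : ∀ q : Nat.Primes, χ ((q : ℕ) : ZMod D) = 0 → P q = (1 - ((q : ℕ) : ℂ) ^ (-(1 : ℂ))) ^ 2 :=
    fun q hz => Phi_one_eq_model_of_apply_eq_zero c' χ j hstar hF q hz
  have hPP' : ∀ q, P q = P' q * d q := by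
    intro q; simp only [hP'def, hddef]
    by_cases hz : χ ((q : ℕ) : ZMod D) = 0
    · rw [if_pos hz, if_pos hz, hPeq q hz, one_mul]
    · rw [if_neg hz, if_neg hz, mul_one]
  have hmm' : ∀ q, m q = m' q * d q := by
    intro q; simp only [hm'def, hddef, hmdef]
    by_cases hz : χ ((q : ℕ) : ZMod D) = 0
    · rw [if_pos hz, if_pos hz, if_pos hz, one_mul]
    · rw [if_neg hz, if_neg hz, if_neg hz, mul_one]
  -- the (H2)-type bound at `2`
  have hB : ∀ e : ℕ, ‖varpi2 c' χ j (2 ^ e)‖ ≤ 2100 * ((e : ℝ) + 1) := by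
    refine norm_varpi2_two_pow_le c' χ j hstar ?_
    split_ifs with h2
    · exact hF 2 Nat.prime_two (Or.inr h2)
    · norm_num
  -- `‖P' − 1‖`
  have hy : ∀ q : Nat.Primes, ‖((q : ℕ) : ℂ) ^ (-(1 : ℂ))‖ = ((q : ℕ) : ℝ)⁻¹ := fun q => by
    rw [Complex.norm_natCast_cpow_of_pos q.prop.pos]; simp [Real.rpow_neg_one]
  have hs1 : 9 / 10 < (1 : ℂ).re := by norm_num
  have hfle : ∀ q : Nat.Primes, ‖P' q - 1‖ ≤ 8568001 * (if (q : ℕ) < 700 then (1 : ℝ) else 0) +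
      30008500 * ((q : ℕ) : ℝ) ^ (-(9 / 5 : ℝ)) := by
    intro q
    have hq := q.prop
    have hpos : 0 ≤ 30008500 * ((q : ℕ) : ℝ) ^ (-(9 / 5 : ℝ)) := by positivity
    simp only [hP'def]
    by_cases hz : χ ((q : ℕ) : ZMod D) = 0
    · rw [if_pos hz, sub_self, norm_zero]; positivity
    rw [if_neg hz, hPdef]; dsimp only
    by_cases hlt : (q : ℕ) < 700
    · rw [if_pos hlt, mul_one]
      by_cases hq2 : (q : ℕ) = 2
      · rw [if_pos hq2]
        have h := norm_Phi_two_sub_one_le_crude c' χ j hB hs1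
        have e2 : ((q : ℕ) : ℂ) = (2 : ℂ) := by rw [hq2]; norm_num
        have e2' : ((q : ℕ) : ZMod D) = (2 : ZMod D) := by rw [hq2]; norm_num
        rw [e2, e2']
        linarith
      · rw [if_neg hq2]
        have h := norm_Phi_sub_one_le_crude c' χ j hq (hF q hq (Or.inl hq2)) hs1
        linarith
    · rw [if_neg hlt, mul_zero, zero_add]
      have h700 : 700 ≤ (q : ℕ) := not_lt.mp hlt
      have hq2 : (q : ℕ) ≠ 2 := by omega
      rw [if_neg hq2]
      have hv : χ ((q : ℕ) : ZMod D) = 1 ∨ χ ((q : ℕ) : ZMod D) = -1 := by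
        rcases hχ ((q : ℕ) : ZMod D) with h | h | h
        · exact absurd h hz
        · exact Or.inl h
        · exact Or.inr h
      have h := norm_Phi_sub_one_le c' χ j hq h700 hv hs1
      obtain ⟨hx1, hx2⟩ := norm_x_bounds hq hs1
      calc _ ≤ 8500 * ‖((q : ℕ) : ℂ) ^ (-(1 : ℂ))‖ / (q : ℕ) + 30000000 * ‖((q : ℕ) : ℂ) ^ (-(1 : ℂ))‖ ^ 2 := h
        _ ≤ 8500 * ((q : ℕ) : ℝ) ^ (-(9 / 5 : ℝ)) + 30000000 * ((q : ℕ) : ℝ) ^ (-(9 / 5 : ℝ)) := by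
            rw [mul_div_assoc]; gcongr
        _ ≤ 30008500 * ((q : ℕ) : ℝ) ^ (-(9 / 5 : ℝ)) := by
            have : 0 ≤ ((q : ℕ) : ℝ) ^ (-(9 / 5 : ℝ)) := by positivity
            nlinarith
  -- `‖m' − 1‖`
  have hgle : ∀ q : Nat.Primes, ‖m' q - 1‖ ≤ 8 * ((q : ℕ) : ℝ) ^ (-(9 / 5 : ℝ)) := by
    intro q
    have hq := q.prop
    have hq1 : (1 : ℝ) ≤ (q : ℕ) := by exact_mod_cast hq.one_lt.le
    have hq0 : (0 : ℝ) < (q : ℕ) := by linarith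
    have h8 : 8 / ((q : ℕ) : ℝ) ^ 2 ≤ 8 * ((q : ℕ) : ℝ) ^ (-(9 / 5 : ℝ)) := by
      have e : (8 : ℝ) / ((q : ℕ) : ℝ) ^ 2 = 8 * ((q : ℕ) : ℝ) ^ (-(2 : ℝ)) := by
        rw [Real.rpow_neg hq0.le, Real.rpow_two, div_eq_mul_inv]
      rw [e]
      exact mul_le_mul_of_nonneg_left (Real.rpow_le_rpow_of_exponent_le hq1 (by norm_num)) (by norm_num)
    simp only [hm'def, hmdef]
    by_cases hz : χ ((q : ℕ) : ZMod D) = 0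
    · rw [if_pos hz, sub_self, norm_zero]; positivity
    rw [if_neg hz, if_neg hz]
    by_cases hsp : ((q : ℕ) = 2 ∧ χ (2 : ZMod D) = 1)
    · rw [if_pos hsp, hsp.1]
      have : ‖(3 / 8 : ℂ) - 1‖ = 5 / 8 := by
        rw [show (3 / 8 : ℂ) - 1 = ((-(5 / 8) : ℝ) : ℂ) by push_cast; norm_num, Complex.norm_real]; norm_num
      rw [this]
      have h2r : (2 : ℝ) ^ (-(9 / 5 : ℝ)) ≥ 2 ^ (-(2 : ℝ)) :=
        Real.rpow_le_rpow_of_exponent_le (by norm_num) (by norm_num)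
      have : (2 : ℝ) ^ (-(2 : ℝ)) = 1 / 4 := by
        rw [Real.rpow_neg (by norm_num), Real.rpow_two]; norm_num
      push_cast
      linarith
    · rw [if_neg hsp]
      have hv : χ ((q : ℕ) : ZMod D) = 1 ∨ χ ((q : ℕ) : ZMod D) = -1 := by
        rcases hχ ((q : ℕ) : ZMod D) with h | h | h
        · exact absurd h hz
        · exact Or.inl h
        · exact Or.inr h
      have h2 : (q : ℕ) = 2 → χ ((q : ℕ) : ZMod D) ≠ 1 := by
        intro hq2 h1; exact hsp ⟨hq2, by rw [hq2] at h1; simpa using h1⟩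
      exact (norm_model_sub_one_le χ hq hv h2).trans h8
  -- `‖P' − m'‖`
  set e : Nat.Primes → ℝ := fun q => 25000000000 * η * (if (q : ℕ) ≤ Q then Real.log (q : ℕ) / (q : ℕ) else 0) +
    (if (q : ℕ) < Q + 1 then (0 : ℝ) else 30008508 * ((q : ℕ) : ℝ) ^ (-((11 / 10 : ℝ) + 7 / 10))) with hedef
  have hEle : ∀ q : Nat.Primes, ‖(P' q - 1) - (m' q - 1)‖ ≤ e q := by
    intro q
    have hq := q.prop
    have hq0 : (0 : ℝ) < (q : ℕ) := by exact_mod_cast hq.pos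
    have hlog0 : 0 ≤ Real.log (q : ℕ) := Real.log_nonneg (by exact_mod_cast hq.one_lt.le)
    have he1 : 0 ≤ 25000000000 * η * (if (q : ℕ) ≤ Q then Real.log (q : ℕ) / (q : ℕ) else 0) := by
      split_ifs <;> positivity
    have he2 : 0 ≤ (if (q : ℕ) < Q + 1 then (0 : ℝ) else 30008508 * ((q : ℕ) : ℝ) ^ (-((11 / 10 : ℝ) + 7 / 10))) := by
      split_ifs <;> positivity
    rw [show (P' q - 1) - (m' q - 1) = P' q - m' q by ring]
    simp only [hP'def, hm'def]
    by_cases hz : χ ((q : ℕ) : ZMod D) = 0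
    · rw [if_pos hz, if_pos hz, sub_self, norm_zero, hedef]; dsimp only; linarith
    rw [if_neg hz, if_neg hz]
    by_cases hqQ : (q : ℕ) ≤ Q
    · -- `q ≤ Q`: the `δ_q` bound
      have h := norm_Phi_one_sub_model_all c' χ j hχ hstar hF q
      have hδq := hδ q hq
      calc ‖P q - m q‖ ≤ 25000000000 * (‖((q : ℕ) : ℂ) ^ (-beta1 c' D) - 1‖ + ‖((q : ℕ) : ℂ) ^ betaJ c' D j - 1‖) / (q : ℕ) := h
        _ ≤ 25000000000 * (η * Real.log (q : ℕ)) / (q : ℕ) := by gcongr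
        _ = 25000000000 * η * (Real.log (q : ℕ) / (q : ℕ)) := by ring
        _ ≤ e q := by rw [hedef]; dsimp only; rw [if_pos hqQ]; linarith
    · -- `q > Q ≥ 700`: the tail bound
      have hQq : Q + 1 ≤ (q : ℕ) := by omega
      have h700 : 700 ≤ (q : ℕ) := by omega
      have hq2 : (q : ℕ) ≠ 2 := by omega
      have hv : χ ((q : ℕ) : ZMod D) = 1 ∨ χ ((q : ℕ) : ZMod D) = -1 := by
        rcases hχ ((q : ℕ) : ZMod D) with h | h | h
        · exact absurd h hz
        · exact Or.inl h
        · exact Or.inr h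
      have h := norm_Phi_one_sub_model_tail c' χ j hq h700 hv
      rw [hPdef, hmdef]; dsimp only
      rw [if_neg hq2, if_neg hz, if_neg (fun h => hq2 h.1)]
      calc _ ≤ 30008508 * ((q : ℕ) : ℝ) ^ (-(9 / 5 : ℝ)) := h
        _ = 30008508 * ((q : ℕ) : ℝ) ^ (-((11 / 10 : ℝ) + 7 / 10)) := by norm_num
        _ ≤ e q := by
            rw [hedef]; dsimp only
            rw [if_neg (by omega : ¬ (q : ℕ) < Q + 1)]
            linarith
  -- summabilities
  obtain ⟨hind_s, hind_le⟩ := tsum_indicator_lt_le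
  obtain ⟨hlog_s, hlog_le⟩ := tsum_indicator_log_div_le Q
  have hfmaj : Summable fun q : Nat.Primes => 8568001 * (if (q : ℕ) < 700 then (1 : ℝ) else 0) +
      30008500 * ((q : ℕ) : ℝ) ^ (-(9 / 5 : ℝ)) := (hind_s.mul_left _).add (hs95.mul_left _)
  have hfs : Summable fun q : Nat.Primes => ‖P' q - 1‖ :=
    Summable.of_nonneg_of_le (fun _ => norm_nonneg _) hfle hfmaj
  have hgs : Summable fun q : Nat.Primes => ‖m' q - 1‖ :=
    Summable.of_nonneg_of_le (fun _ => norm_nonneg _) hgle (hs95.mul_left _)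
  have htail_s := Literature.Analysis.Complex.summable_primeTail (C := 30008508) (a := 11 / 10) (δ := 7 / 10)
    (by norm_num) (by norm_num) (by norm_num) (D := Q + 1) (by omega)
  have htail_le := Literature.Analysis.Complex.tsum_primeTail_le (C := 30008508) (a := 11 / 10) (δ := 7 / 10)
    (by norm_num) (by norm_num) (by norm_num) (D := Q + 1) (by omega)
  have hes : Summable e := ((hlog_s.mul_left (25000000000 * η)).add htail_s)
  have hes_le : ∑' q, e q ≤ 25000000000 * η * (Real.log Q + Real.log 4) +
      30008508 * ((Q + 1 : ℕ) : ℝ) ^ (-(7 / 10 : ℝ)) * S11 := by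
    rw [hedef]
    rw [((hlog_s.mul_left (25000000000 * η)).tsum_add htail_s), tsum_mul_left]
    gcongr
  -- sums of `‖f‖`, `‖g‖`
  have hfsum_le : ∑' q, ‖P' q - 1‖ ≤ A0 := by
    calc _ ≤ ∑' q : Nat.Primes, (8568001 * (if (q : ℕ) < 700 then (1 : ℝ) else 0) + 30008500 * ((q : ℕ) : ℝ) ^ (-(9 / 5 : ℝ))) :=
          Summable.tsum_le_tsum hfle hfs hfmaj
      _ = 8568001 * ∑' q : Nat.Primes, (if (q : ℕ) < 700 then (1 : ℝ) else 0) + 30008500 * S95 := by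
          rw [((hind_s.mul_left _).tsum_add (hs95.mul_left _)), tsum_mul_left, tsum_mul_left]
      _ ≤ 8568001 * 700 + 30008508 * S95 := by gcongr; norm_num
      _ = A0 := by rw [hA0]
  have hgsum_le : ∑' q, ‖m' q - 1‖ ≤ 8 * S95 := by
    calc _ ≤ ∑' q : Nat.Primes, 8 * ((q : ℕ) : ℝ) ^ (-(9 / 5 : ℝ)) := Summable.tsum_le_tsum hgle hgs (hs95.mul_left _)
      _ = 8 * S95 := tsum_mul_left
  have hdiff_s : Summable fun q : Nat.Primes => ‖(P' q - 1) - (m' q - 1)‖ :=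
    Summable.of_nonneg_of_le (fun _ => norm_nonneg _) hEle hes
  have hdiff_le : ∑' q, ‖(P' q - 1) - (m' q - 1)‖ ≤ ∑' q, e q := Summable.tsum_le_tsum hEle hdiff_s hes
  -- the products
  have hcmp := norm_tprod_one_add_sub_tprod_one_add_le hfs hgs
  have e1 : ∏' q : Nat.Primes, (1 + (P' q - 1)) = ∏' q, P' q := tprod_congr fun q => by ring
  have e2 : ∏' q : Nat.Primes, (1 + (m' q - 1)) = ∏' q, m' q := tprod_congr fun q => by ring
  rw [e1, e2] at hcmp
  -- `∏' P = (∏' P')·dval`, `frakU2Main = (∏' m')·dval`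
  have hP'm : Multipliable P' := by
    have h := multipliable_one_add_of_summable hfs
    simpa only [add_sub_cancel] using h
  have hm'm : Multipliable m' := by
    have h := multipliable_one_add_of_summable hgs
    simpa only [add_sub_cancel] using h
  set T : Finset Nat.Primes := D.primeFactors.subtype Nat.Prime with hT
  have hmemT : ∀ q : Nat.Primes, χ ((q : ℕ) : ZMod D) = 0 → q ∈ T := by
    intro q hz
    have h : q ∈ T ↔ (q : ℕ) ∈ D.primeFactors := Finset.mem_subtype
    rw [h, Nat.mem_primeFactors]
    exact ⟨q.prop, dvd_of_apply_eq_zero χ q.prop hz, NeZero.ne D⟩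
  have hd : HasProd d (∏ q ∈ T, d q) := by
    refine hasProd_prod_of_ne_finset_one fun q hq => ?_
    simp only [hddef]
    rw [if_neg (fun hz => hq (hmemT q hz))]
  have hPprod : HasProd P ((∏' q, P' q) * ∏ q ∈ T, d q) :=
    (hP'm.hasProd.mul hd).congr_fun fun q => hPP' q
  have hmprod : HasProd m ((∏' q, m' q) * ∏ q ∈ T, d q) :=
    (hm'm.hasProd.mul hd).congr_fun fun q => hmm' q
  have hmain : frakU2Main χ = (∏' q, m' q) * ∏ q ∈ T, d q :=
    (hasProd_model χ (NeZero.ne D) hχ).unique hmprod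
  rw [hPprod.tprod_eq, hmain, ← sub_mul, norm_mul]
  -- `‖dval‖ ≤ 1`
  have hdn : ‖∏ q ∈ T, d q‖ ≤ 1 := by
    rw [norm_prod]
    refine Finset.prod_le_one (fun q _ => norm_nonneg _) fun q _ => ?_
    simp only [hddef]
    split_ifs
    · rw [norm_pow]
      have hx : ‖(1 : ℂ) - ((q : ℕ) : ℂ) ^ (-(1 : ℂ))‖ ≤ 1 := by
        rw [Complex.cpow_neg_one, show (1 : ℂ) - (((q : ℕ) : ℂ))⁻¹ = ((1 - ((q : ℕ) : ℝ)⁻¹ : ℝ) : ℂ) by push_cast; ring,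
          Complex.norm_real, Real.norm_eq_abs]
        have hq1 : (1 : ℝ) ≤ (q : ℕ) := by exact_mod_cast q.prop.one_lt.le
        have h0 : 0 ≤ ((q : ℕ) : ℝ)⁻¹ := by positivity
        have h1 : ((q : ℕ) : ℝ)⁻¹ ≤ 1 := inv_le_one_of_one_le₀ hq1
        rw [abs_of_nonneg (by linarith)]; linarith
      exact pow_le_one₀ (norm_nonneg _) hx
    · simp
  -- assemble
  have hlog4 : Real.log 4 ≤ 2 := by
    have : Real.log 4 ≤ (4 : ℝ) - 1 := Real.log_le_sub_one_of_pos (by norm_num)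
    have h2 : Real.log 4 = 2 * Real.log 2 := by
      rw [show (4 : ℝ) = 2 ^ 2 by norm_num, Real.log_pow]; norm_num
    have h3 : Real.log 2 ≤ 1 := by
      have := Real.log_le_sub_one_of_pos (show (0:ℝ) < 2 by norm_num); linarith
    linarith
  have hexp : Real.exp (∑' q, ‖P' q - 1‖ + ∑' q, ‖m' q - 1‖) ≤ Real.exp (A0 + 8 * S95) :=
    Real.exp_le_exp.mpr (add_le_add hfsum_le hgsum_le)
  have hQ1 : ((Q + 1 : ℕ) : ℝ) = (Q : ℝ) + 1 := by push_cast; ring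
  have hlogQ : 0 ≤ Real.log Q := Real.log_nonneg (by exact_mod_cast (show 1 ≤ Q by omega))
  have hQp : 0 ≤ ((Q : ℝ) + 1) ^ (-(7 / 10 : ℝ)) := by positivity
  have hcore : ‖∏' q, P' q - ∏' q, m' q‖ ≤ Real.exp (A0 + 8 * S95) *
      (25000000000 * η * (Real.log Q + Real.log 4) + 30008508 * (((Q : ℝ) + 1) ^ (-(7 / 10 : ℝ))) * S11) := by
    rw [← hQ1]
    calc _ ≤ Real.exp (∑' q, ‖P' q - 1‖ + ∑' q, ‖m' q - 1‖) * ∑' q, ‖(P' q - 1) - (m' q - 1)‖ := hcmp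
      _ ≤ _ := mul_le_mul hexp (hdiff_le.trans hes_le) (tsum_nonneg fun _ => norm_nonneg _) (Real.exp_pos _).le
  have hfinal := real_final_bound (Real.exp_pos (A0 + 8 * S95)).le hη hlogQ hQp hS11n hlog4
  rw [hK]
  calc ‖∏' q, P' q - ∏' q, m' q‖ * ‖∏ q ∈ T, d q‖ ≤ ‖∏' q, P' q - ∏' q, m' q‖ * 1 :=
        mul_le_mul_of_nonneg_left hdn (norm_nonneg _)
    _ ≤ _ := by rw [mul_one]; exact hcore.trans hfinal

end ValueMain


end Literature.NumberTheory.LFunctions.Zhang2022.Lemma162R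

end
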